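import Summits.ResolutionOfSingularities.ResolutionOfSingularities.Theses.Valuative
import Literature.AlgebraicGeometry.Resolution.ZariskiPatchingAllDimensions
import Literature.AlgebraicGeometry.Resolution.BadCurveInduction
import Literature.AlgebraicGeometry.Resolution.ResolutionOfCurves
import Literature.Barriers.ResolutionOfSingularities.DimensionFourFrontier
import HarnessLib

/-!
# Line `dimension-ladder` on crux `PatchingRel` (stmt-ResolutionOfSingularities-0642) — WITNESS FILE (F3 / BC5)

The rung family of `Lines/PatchingRelUpToDim4.lean`, restated verbatim (this file is
self-contained so the tribunal can re-elaborate it alone), SPECIALISES TO ITS PROVED FLOOR θ₀ = 3: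

* `rung_three`            : `CossartPiltant2019 → PatchingRelUpToDim 3` (Cossart–Piltant 2019 Thm. 1.1; LU idle);
* `rung_three_of_patching`: `CossartJannsenSaito2020 → CossartPiltant2019Patching → PatchingRelUpToDim 3`
  — the PATCHING floor with LU load-bearing (Cossart–Piltant 2019 Prop. 4.6 = Zariski 1944 p. 539 /
  Piltant 2013 Prop. 5.1 + Cor. 5.7 in transcendence degree 3);
* `rung_three_of_principalization`: the same with the patching PROVED in the tree from
  Cossart–Piltant's principalization on regular threefolds
  (`CossartPiltant2019Patching.of_principalization`, `BadCurveInduction.lean`) — a proof of the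
  floor that does not pass through resolution of threefolds;
* `rung_one` unconditionally (curves), `rung_two` from `CossartJannsenSaito2020`.

No `sorry`. The next rung θ₁ = 4 (`stub_patchingRelUpToDim_four` of the line file) is NOT proved
here or anywhere: `rung_three → rung 4` and `CossartPiltant2019 → rung 4` fail the cheap portfolio
(`bc/PatchingRelUpToDim4_probeA.lean`, P-A3/P-A4).
-/

set_option linter.dupNamespace false

noncomputable section

namespace Summit.ResolutionOfSingularities.ResolutionOfSingularities.Cruxes.PatchingRel.DimensionLadder.Special

open CategoryTheory AlgebraicGeometry
open Literature.AlgebraicGeometry.Resolution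
open Literature.Barriers.ResolutionOfSingularities
open Summit.ResolutionOfSingularities.ResolutionOfSingularities

/-- `LUrel_p`, the antecedent of the crux, verbatim. [this project, Theses/Valuative.lean] -/
def LUrel (p : ℕ) : Prop :=
  ∀ (k K : Type) [Field k] [CharP k p] [Field K] [Algebra k K], (⊤ : IntermediateField k K).FG →
    ∀ O : ValuationSubring K, (∀ c : k, algebraMap k K c ∈ O) → ∀ R : Subalgebra k K, R.FG →
      R.toSubring ≤ O.toSubring → ∃ (A : Subalgebra k K) (h : A.toSubring ≤ O.toSubring),
        R ≤ A ∧ A.FG ∧ IsFractionRing A K ∧ IsRegularLocalRing (Localization.AtPrime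
          (Ideal.comap (Subring.inclusion h) (IsLocalRing.maximalIdeal O)))

/-- The rung family (verbatim the line file's `PatchingRelUpToDim`). [folklore] -/
def PatchingRelUpToDim (n : ℕ) : Prop :=
  ∀ p : ℕ, p.Prime → LUrel p → ∀ (k : Type) [Field k] [CharP k p], ResolutionOverUpToDim.{0} k n

/-- The family is the one whose member `4` is the registered stub (syntactic identity with
`stub_patchingRelUpToDim_four`, up to the numeral). [folklore] -/
example : PatchingRelUpToDim 4 ↔
    (∀ p : ℕ, p.Prime → (∀ (k K : Type) [Field k] [CharP k p] [Field K] [Algebra k K], (⊤ : IntermediateField k K).FG → ∀ O : ValuationSubring K, (∀ c : k, algebraMap k K c ∈ O) → ∀ R : Subalgebra k K, R.FG → R.toSubring ≤ O.toSubring → ∃ (A : Subalgebra k K) (h : A.toSubring ≤ O.toSubring), R ≤ A ∧ A.FG ∧ IsFractionRing A K ∧ IsRegularLocalRing (Localization.AtPrime (Ideal.comap (Subring.inclusion h) (IsLocalRing.maximalIdeal O)))) → ∀ (k : Type) [Field k] [CharP k p], Literature.AlgebraicGeometry.Resolution.ResolutionOverUpToDim.{0} k 4) :=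
  Iff.rfl

/-- `LUrel_p` gives the LU half of the technique class in every dimension. [folklore] -/
theorem localUniformizationUpToDim_of_lurel {p : ℕ} (hLU : LUrel p) (k : Type) [Field k]
    [CharP k p] (n : ℕ) : LocalUniformizationUpToDim.{0} k n := by
  intro K _ _ O A hAO hAfg hAfr _
  haveI : Algebra.FiniteType k A := A.fg_iff_finiteType.mp hAfg
  haveI : IsFractionRing A K := hAfr
  haveI : Algebra.EssFiniteType A K :=
    Algebra.EssFiniteType.of_isLocalization K (nonZeroDivisors A)
  have hKfg : (⊤ : IntermediateField k K).FG :=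
    IntermediateField.fg_top_iff.mpr (Algebra.EssFiniteType.comp k A K)
  obtain ⟨A', h, hle, hA'fg, -, hreg⟩ :=
    hLU k K hKfg O (fun c => hAO (A.algebraMap_mem c)) A hAfg hAO
  exact ⟨A', h, hle, hA'fg, hreg⟩

/-- WITNESS (floor θ₀ = 3, LU idle): Cossart–Piltant's theorem. [cite: CossartPiltant2019, Thm. 1.1] -/
theorem rung_three (h3 : CossartPiltant2019.{0}) : PatchingRelUpToDim 3 :=
  fun _ _ _ k _ => cossartPiltant2019_iff.mp h3 k

/-- The brief's F3 shape: the rung specialised to the floor `by simpa using` the floor decl. -/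
example (h3 : CossartPiltant2019.{0}) : PatchingRelUpToDim 3 := by
  simpa [PatchingRelUpToDim] using fun (p : ℕ) (_ : p.Prime) (_ : LUrel p) (k : Type)
    (_ : Field k) (_ : CharP k p) => cossartPiltant2019_iff.mp h3 k

/-- WITNESS (patching floor θ₀ = 3, LU LOAD-BEARING): surface resolution and Cossart–Piltant's
enhanced Zariski patching turn `LUrel_p` into resolution up to dimension `3`.
[cite: CossartPiltant2019, Prop. 4.6 (arXiv v1: Prop. 4.4), patching] -/
theorem rung_three_of_patching (hCJS : CossartJannsenSaito2020.{0})
    (hP3 : CossartPiltant2019Patching.{0}) : PatchingRelUpToDim 3 :=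
  fun _ _ hLU k _ _ => hP3 k (hCJS k)
    ((localUniformizationUpToDim_three_iff k).mp (localUniformizationUpToDim_of_lurel hLU k 3))

/-- WITNESS with the patching proved in the tree from principalization on regular threefolds
(Zariski compactness + Piltant Prop. 5.1 by the bad-curve induction).
[cite: Piltant2013, Prop. 5.1 and Cor. 5.7] -/
theorem rung_three_of_principalization (hCJS : CossartJannsenSaito2020.{0})
    (hPr : CossartPiltant2019Principalization.{0}) : PatchingRelUpToDim 3 :=
  rung_three_of_patching hCJS (CossartPiltant2019Patching.of_principalization hPr)

/-- Rung `1`, unconditionally. [folklore] -/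
theorem rung_one : PatchingRelUpToDim 1 :=
  fun _ _ _ k _ _ => resolutionOverUpToDim_one k

/-- Rung `2` from resolution of surfaces. [cite: CossartJannsenSaito2020, Thm. 1.2] -/
theorem rung_two (hCJS : CossartJannsenSaito2020.{0}) : PatchingRelUpToDim 2 :=
  fun _ _ _ k _ => hCJS k

end Summit.ResolutionOfSingularities.ResolutionOfSingularities.Cruxes.PatchingRel.DimensionLadder.Special

end
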